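import Literature.MathematicalPhysics.QuantumFieldTheory.ShenZhuZhuPoincareApplications
import Literature.MathematicalPhysics.QuantumLattice.WilsonLoopsProofs
import HarnessLib

/-!
# Shen–Zhu–Zhu, CMP 400 (2023), Corollary 1.5: the factorisation of Wilson loops as `N → ∞`,
# PROVED from the variance bound (1.12)

H. Shen, R. Zhu, X. Zhu, *A stochastic analysis approach to lattice Yang–Mills at strong coupling*,
CMP 400 (2023) 805–851 = arXiv:2204.12737, Corollary 1.5 [ShenZhuZhuCMP2023]. The tree holds the
variance bound (1.12) of that corollary as the named fact `shenZhuZhu_largeN_variance`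
(`ShenZhuZhuPoincareApplications.lean`, whose docstring leaves the printed consequences — (1.13) and
the factorisation — as "TODO(proved corollary)"). This file PROVES the factorisation property
"for any loops `ℓ₁, …, ℓ_m`, `lim_{N→∞} |𝐄 (W_{ℓ₁}⋯W_{ℓ_m}/N^m) − Π_i 𝐄 (W_{ℓ_i}/N)| = 0`" from that fact,
following the printed proof (§4.2, last display, p. 24): by Cauchy–Schwarz and `|W_ℓ/N| ≤ 1`,
`N^{-m}|𝐄(W_{ℓ₁}⋯W_{ℓ_m}) − 𝐄(W_{ℓ₁}⋯W_{ℓ_{m-1}})𝐄 W_{ℓ_m}| ≤ Var(W_{ℓ_m}/N)^{1/2} → 0`, "hence the result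
follows by induction".

## Contents

* Abstract probability (any probability space, complex observables bounded by `1`):
  `norm_integral_prod_sub_prod_integral_le` — `‖𝐄 Π_{i<k} X_i − Π_{i<k} 𝐄 X_i‖ ≤ Σ_{i<k} 𝐄‖X_i − 𝐄X_i‖`
  (the printed induction, telescoped); `integral_norm_sub_le_sqrt_variance` —
  `𝐄‖X − 𝐄X‖ ≤ (Var(Re X) + Var(Im X))^{1/2}` (Cauchy–Schwarz / Jensen);
  `tendsto_integral_prod_sub_prod_integral` — factorisation along any family of probability spaces
  indexed by `N` once the variances are dominated by null sequences.
* (private) `norm_trace_le_of_mem_unitaryGroup` — `‖Tr V‖ ≤ N` for `V ∈ U(N)`; `norm_wilsonLoopTrace_fundamentalRep_div_le`, `…_specialOrthogonalRep_div_le` — `|W_ℓ/N| ≤ 1`.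
* `shenZhuZhu_largeN_factorization_SU`, `shenZhuZhu_largeN_factorization_SO` — Corollary 1.5's
  factorisation for `G = SU(N)` and `G = SO(N)`, each from `∀ N, shenZhuZhu_largeN_variance d N`:
  for `d ≥ 2`, 't Hooft coupling `|β| < 1/(16(d−1))` (`SU(N)`, Assumption 1.1 uniformly in `N`) resp.
  `|β| ≤ β₀ < 1/(32(d−1))` (`SO(N)`, so that Assumption 1.1 `|β| < 1/(32(d−1)) − 1/(16N(d−1))` holds
  for all large `N`), any choice `μ_N ∈ infiniteVolumeLimitPoints ρ_N (Nβ)` and loops `ℓ₁, …, ℓ_m`: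
  `𝐄_{μ_N} Π_i (W_{ℓ_i}/N) − Π_i 𝐄_{μ_N}(W_{ℓ_i}/N) → 0` as `N → ∞`.

No new named facts; nothing here is a claim about the Yang–Mills mass gap.
-/

noncomputable section

open MeasureTheory ProbabilityTheory Filter Topology
open scoped NNReal
open Literature.MathematicalPhysics.QuantumLattice
open Literature.Probability.LatticeModels (zdGraph)
open Literature.MathematicalPhysics.QuantumFieldTheory.Balaban1983to89.TraceWordsSeparateOrbitsOrthogonal

namespace Literature.MathematicalPhysics.QuantumFieldTheory

/-! ### Abstract probability: products of bounded complex observables -/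

section Abstract

variable {Ω : Type*} [MeasurableSpace Ω] {μ : Measure Ω}

omit [MeasurableSpace Ω] in
/-- A product of functions bounded by `1` in norm is bounded by `1`. [folklore] -/
private theorem norm_prod_range_le_one (X : ℕ → Ω → ℂ) (hXb : ∀ i ω, ‖X i ω‖ ≤ 1) (k : ℕ) (ω : Ω) :
    ‖∏ i ∈ Finset.range k, X i ω‖ ≤ 1 := by
  induction k with
  | zero => simp
  | succ k ih =>
    rw [Finset.prod_range_succ, norm_mul]
    exact mul_le_one₀ ih (norm_nonneg _) (hXb k ω)

variable [IsProbabilityMeasure μ]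

/-- On a probability space, the integral of a function bounded by `C` in norm has norm `≤ C`. [folklore] -/
private theorem norm_integral_le_of_forall_norm_le {E : Type*} [NormedAddCommGroup E] [NormedSpace ℝ E]
    {f : Ω → E} {C : ℝ} (hf : ∀ ω, ‖f ω‖ ≤ C) : ‖∫ ω, f ω ∂μ‖ ≤ C := by
  calc ‖∫ ω, f ω ∂μ‖ ≤ C * (μ Set.univ).toReal :=
        norm_integral_le_of_norm_le_const (Eventually.of_forall hf)
    _ = C := by simp

/-- **The telescoped induction of SZZ's proof of Corollary 1.5**: for complex observables `X_i` with
`‖X_i‖ ≤ 1` on a probability space,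
`‖𝐄[Π_{i<k} X_i] − Π_{i<k} 𝐄[X_i]‖ ≤ Σ_{i<k} 𝐄‖X_i − 𝐄[X_i]‖`.
Step: `𝐄[P X_k] − e·𝐄X_k = 𝐄[P (X_k − 𝐄X_k)] + (𝐄P − e) 𝐄X_k` with `‖P‖ ≤ 1`, `‖𝐄X_k‖ ≤ 1`.
[cite: ShenZhuZhuCMP2023, §4.2 proof of Corollary 1.5 (last display: "the result follows by induction")] -/
theorem norm_integral_prod_sub_prod_integral_le (X : ℕ → Ω → ℂ)
    (hXm : ∀ i, AEStronglyMeasurable (X i) μ) (hXb : ∀ i ω, ‖X i ω‖ ≤ 1) (k : ℕ) :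
    ‖(∫ ω, ∏ i ∈ Finset.range k, X i ω ∂μ) - ∏ i ∈ Finset.range k, ∫ ω, X i ω ∂μ‖ ≤
      ∑ i ∈ Finset.range k, ∫ ω, ‖X i ω - ∫ ω', X i ω' ∂μ‖ ∂μ := by
  induction k with
  | zero => simp
  | succ k ih =>
    -- abbreviations
    set P : Ω → ℂ := fun ω => ∏ i ∈ Finset.range k, X i ω with hP
    set e : ℂ := ∏ i ∈ Finset.range k, ∫ ω, X i ω ∂μ with he
    set c : ℂ := ∫ ω, X k ω ∂μ with hc
    have hPm : AEStronglyMeasurable P μ :=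
      Finset.aestronglyMeasurable_fun_prod _ fun i _ => hXm i
    have hPb : ∀ ω, ‖P ω‖ ≤ 1 := norm_prod_range_le_one X hXb k
    have hPi : Integrable P μ := Integrable.of_bound hPm 1 (Eventually.of_forall hPb)
    have hXi : Integrable (X k) μ := Integrable.of_bound (hXm k) 1 (Eventually.of_forall (hXb k))
    have hPXi : Integrable (fun ω => P ω * X k ω) μ :=
      Integrable.of_bound (hPm.mul (hXm k)) 1 (Eventually.of_forall fun ω => by
        rw [norm_mul]; exact mul_le_one₀ (hPb ω) (norm_nonneg _) (hXb k ω))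
    have hPci : Integrable (fun ω => P ω * c) μ := hPi.mul_const c
    have hc1 : ‖c‖ ≤ 1 := norm_integral_le_of_forall_norm_le (hXb k)
    -- rewrite the `k+1` products
    have h1 : (fun ω => ∏ i ∈ Finset.range (k + 1), X i ω) = fun ω => P ω * X k ω := by
      funext ω; simp [hP, Finset.prod_range_succ]
    have h2 : ∏ i ∈ Finset.range (k + 1), ∫ ω, X i ω ∂μ = e * c := by
      rw [Finset.prod_range_succ]
    rw [h1, h2, Finset.sum_range_succ]
    -- the decomposition
    have hdec : (∫ ω, P ω * X k ω ∂μ) - e * c =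
        (∫ ω, P ω * (X k ω - c) ∂μ) + ((∫ ω, P ω ∂μ) - e) * c := by
      have hsplit : (fun ω => P ω * (X k ω - c)) = fun ω => P ω * X k ω - P ω * c := by
        funext ω; ring
      rw [hsplit, integral_sub hPXi hPci, integral_mul_const]
      ring
    rw [hdec]
    -- first term: `‖∫ P (X_k - c)‖ ≤ ∫ ‖X_k - c‖`
    have hXci : Integrable (fun ω => ‖X k ω - c‖) μ := (hXi.sub (integrable_const c)).norm
    have hT1 : ‖∫ ω, P ω * (X k ω - c) ∂μ‖ ≤ ∫ ω, ‖X k ω - c‖ ∂μ := by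
      refine (norm_integral_le_integral_norm _).trans (integral_mono_of_nonneg
        (Eventually.of_forall fun ω => norm_nonneg _) hXci (Eventually.of_forall fun ω => ?_))
      show ‖P ω * (X k ω - c)‖ ≤ ‖X k ω - c‖
      rw [norm_mul]
      exact mul_le_of_le_one_left (norm_nonneg _) (hPb ω)
    -- second term: `‖(∫P - e) c‖ ≤ ‖∫P - e‖`
    have hT2 : ‖((∫ ω, P ω ∂μ) - e) * c‖ ≤ ‖(∫ ω, P ω ∂μ) - e‖ := by
      rw [norm_mul]
      exact mul_le_of_le_one_right (norm_nonneg _) hc1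
    calc ‖(∫ ω, P ω * (X k ω - c) ∂μ) + ((∫ ω, P ω ∂μ) - e) * c‖
        ≤ ‖∫ ω, P ω * (X k ω - c) ∂μ‖ + ‖((∫ ω, P ω ∂μ) - e) * c‖ := norm_add_le _ _
      _ ≤ (∫ ω, ‖X k ω - c‖ ∂μ) + ‖(∫ ω, P ω ∂μ) - e‖ := add_le_add hT1 hT2
      _ ≤ (∫ ω, ‖X k ω - c‖ ∂μ) + ∑ i ∈ Finset.range k, ∫ ω, ‖X i ω - ∫ ω', X i ω' ∂μ‖ ∂μ := by
          gcongr
      _ = (∑ i ∈ Finset.range k, ∫ ω, ‖X i ω - ∫ ω', X i ω' ∂μ‖ ∂μ) + ∫ ω, ‖X k ω - c‖ ∂μ :=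
          add_comm _ _

/-- **Cauchy–Schwarz step of SZZ's proof of Corollary 1.5**: for a complex observable `X` with
`‖X‖ ≤ 1` on a probability space, `𝐄‖X − 𝐄X‖ ≤ (Var(Re X) + Var(Im X))^{1/2}` — indeed
`(𝐄 Y)² ≤ 𝐄 Y²` for `Y = ‖X − 𝐄X‖` and `𝐄 Y² = 𝐄(Re X − 𝐄 Re X)² + 𝐄(Im X − 𝐄 Im X)²`.
[cite: ShenZhuZhuCMP2023, §4.2 proof of Corollary 1.5 ("by the Cauchy–Schwarz inequality … ≤ Var(W_{ℓ_n}/N)^{1/2}")] -/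
theorem integral_norm_sub_le_sqrt_variance (X : Ω → ℂ) (hXm : AEStronglyMeasurable X μ)
    (hXb : ∀ ω, ‖X ω‖ ≤ 1) :
    ∫ ω, ‖X ω - ∫ ω', X ω' ∂μ‖ ∂μ ≤
      Real.sqrt (Var[fun ω => (X ω).re; μ] + Var[fun ω => (X ω).im; μ]) := by
  set c : ℂ := ∫ ω', X ω' ∂μ with hc
  set Y : Ω → ℝ := fun ω => ‖X ω - c‖ with hY
  have hXi : Integrable X μ := Integrable.of_bound hXm 1 (Eventually.of_forall hXb)
  have hYm : AEStronglyMeasurable Y μ := (hXm.sub aestronglyMeasurable_const).norm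
  have hYb : ∀ ω, ‖Y ω‖ ≤ 2 := fun ω => by
    rw [hY, Real.norm_eq_abs, abs_norm]
    calc ‖X ω - c‖ ≤ ‖X ω‖ + ‖c‖ := norm_sub_le _ _
      _ ≤ 1 + 1 := add_le_add (hXb ω) (norm_integral_le_of_forall_norm_le hXb)
      _ = 2 := by norm_num
  have hY2 : MemLp Y 2 μ := MemLp.of_bound hYm 2 (Eventually.of_forall hYb)
  have hY0 : 0 ≤ ∫ ω, Y ω ∂μ := integral_nonneg fun ω => norm_nonneg _
  -- `(∫ Y)^2 ≤ ∫ Y^2`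
  have hsq : (∫ ω, Y ω ∂μ) ^ 2 ≤ ∫ ω, Y ω ^ 2 ∂μ := by
    have hv := variance_nonneg Y μ
    rw [variance_eq_sub hY2] at hv
    have : μ[Y ^ 2] = ∫ ω, Y ω ^ 2 ∂μ := rfl
    linarith
  -- `∫ Y^2 = Var(Re X) + Var(Im X)`
  have hre : (∫ ω', X ω' ∂μ).re = ∫ ω', (X ω').re ∂μ := by
    have := integral_re hXi
    simpa using this.symm
  have him : (∫ ω', X ω' ∂μ).im = ∫ ω', (X ω').im ∂μ := by
    have := integral_im hXi
    simpa using this.symm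
  have hReM : AEMeasurable (fun ω => (X ω).re) μ :=
    (Complex.continuous_re.comp_aestronglyMeasurable hXm).aemeasurable
  have hImM : AEMeasurable (fun ω => (X ω).im) μ :=
    (Complex.continuous_im.comp_aestronglyMeasurable hXm).aemeasurable
  have hY2eq : ∀ ω, Y ω ^ 2 =
      ((X ω).re - ∫ ω', (X ω').re ∂μ) ^ 2 + ((X ω).im - ∫ ω', (X ω').im ∂μ) ^ 2 := by
    intro ω
    rw [hY, Complex.sq_norm, Complex.normSq_apply, Complex.sub_re, Complex.sub_im, ← hre, ← him]
    ring
  have hReI : Integrable (fun ω => ((X ω).re - ∫ ω', (X ω').re ∂μ) ^ 2) μ := by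
    refine Integrable.of_bound ?_ 4 (Eventually.of_forall fun ω => ?_)
    · exact ((hReM.sub aemeasurable_const).pow_const 2).aestronglyMeasurable
    · have h1 : |(X ω).re| ≤ 1 := (Complex.abs_re_le_norm _).trans (hXb ω)
      have h2 : |∫ ω', (X ω').re ∂μ| ≤ 1 := by
        rw [← hre]; exact (Complex.abs_re_le_norm _).trans (norm_integral_le_of_forall_norm_le hXb)
      rw [Real.norm_eq_abs, abs_pow, sq_abs]
      nlinarith [abs_sub _ _ |>.trans (add_le_add h1 h2), abs_nonneg ((X ω).re - ∫ ω', (X ω').re ∂μ),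
        sq_abs ((X ω).re - ∫ ω', (X ω').re ∂μ)]
  have hImI : Integrable (fun ω => ((X ω).im - ∫ ω', (X ω').im ∂μ) ^ 2) μ := by
    refine Integrable.of_bound ?_ 4 (Eventually.of_forall fun ω => ?_)
    · exact ((hImM.sub aemeasurable_const).pow_const 2).aestronglyMeasurable
    · have h1 : |(X ω).im| ≤ 1 := (Complex.abs_im_le_norm _).trans (hXb ω)
      have h2 : |∫ ω', (X ω').im ∂μ| ≤ 1 := by
        rw [← him]; exact (Complex.abs_im_le_norm _).trans (norm_integral_le_of_forall_norm_le hXb)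
      rw [Real.norm_eq_abs, abs_pow, sq_abs]
      nlinarith [abs_sub _ _ |>.trans (add_le_add h1 h2), abs_nonneg ((X ω).im - ∫ ω', (X ω').im ∂μ),
        sq_abs ((X ω).im - ∫ ω', (X ω').im ∂μ)]
  have hvar : ∫ ω, Y ω ^ 2 ∂μ = Var[fun ω => (X ω).re; μ] + Var[fun ω => (X ω).im; μ] := by
    rw [variance_eq_integral hReM, variance_eq_integral hImM]
    simp_rw [hY2eq]
    rw [integral_add hReI hImI]
  -- conclude
  calc ∫ ω, ‖X ω - ∫ ω', X ω' ∂μ‖ ∂μ = ∫ ω, Y ω ∂μ := rfl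
    _ = Real.sqrt ((∫ ω, Y ω ∂μ) ^ 2) := (Real.sqrt_sq hY0).symm
    _ ≤ Real.sqrt (∫ ω, Y ω ^ 2 ∂μ) := Real.sqrt_le_sqrt hsq
    _ = _ := by rw [hvar]

end Abstract

/-! ### Factorisation along a family of probability spaces -/

/-- **Factorisation from vanishing variances.** Let `(Ω_N, μ_N)` be probability spaces (for all large
`N`) carrying complex observables `X^N_1, …, X^N_m` with `‖X^N_i‖ ≤ 1`, and suppose
`Var(Re X^N_i) + Var(Im X^N_i) ≤ b_i(N)` with `b_i(N) → 0` as `N → ∞`. Then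
`𝐄[Π_i X^N_i] − Π_i 𝐄[X^N_i] → 0`. (The printed route: Cauchy–Schwarz and induction.)
[cite: ShenZhuZhuCMP2023, §4.2 proof of Corollary 1.5 (factorisation)] -/
theorem tendsto_integral_prod_sub_prod_integral {Ω : ℕ → Type*} [∀ N, MeasurableSpace (Ω N)]
    (μ : ∀ N, Measure (Ω N)) (hμ : ∀ᶠ N in atTop, IsProbabilityMeasure (μ N)) (m : ℕ)
    (X : ∀ N, ℕ → Ω N → ℂ) (hXm : ∀ᶠ N in atTop, ∀ i, AEStronglyMeasurable (X N i) (μ N))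
    (hXb : ∀ N i ω, ‖X N i ω‖ ≤ 1) (b : ℕ → ℕ → ℝ) (hb : ∀ i, Tendsto (b i) atTop (𝓝 0))
    (hvar : ∀ᶠ N in atTop, ∀ i, i < m →
      Var[fun ω => (X N i ω).re; μ N] + Var[fun ω => (X N i ω).im; μ N] ≤ b i N) :
    Tendsto (fun N => (∫ ω, ∏ i ∈ Finset.range m, X N i ω ∂μ N) -
        ∏ i ∈ Finset.range m, ∫ ω, X N i ω ∂μ N) atTop (𝓝 0) := by
  -- the dominating sequence `Σ_i √(max (b_i N) 0)`
  have hlim : Tendsto (fun N => ∑ i ∈ Finset.range m, Real.sqrt (b i N)) atTop (𝓝 0) := by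
    have : (0 : ℝ) = ∑ i ∈ Finset.range m, Real.sqrt 0 := by simp
    rw [this]
    exact tendsto_finsetSum _ fun i _ => (hb i).sqrt
  refine squeeze_zero_norm' ?_ hlim
  filter_upwards [hμ, hXm, hvar] with N hμN hXmN hvarN
  haveI := hμN
  calc ‖(∫ ω, ∏ i ∈ Finset.range m, X N i ω ∂μ N) - ∏ i ∈ Finset.range m, ∫ ω, X N i ω ∂μ N‖
      ≤ ∑ i ∈ Finset.range m, ∫ ω, ‖X N i ω - ∫ ω', X N i ω' ∂μ N‖ ∂μ N :=
        norm_integral_prod_sub_prod_integral_le (X N) hXmN (hXb N) m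
    _ ≤ ∑ i ∈ Finset.range m,
          Real.sqrt (Var[fun ω => (X N i ω).re; μ N] + Var[fun ω => (X N i ω).im; μ N]) :=
        Finset.sum_le_sum fun i _ => integral_norm_sub_le_sqrt_variance (X N i) (hXmN i) (hXb N i)
    _ ≤ ∑ i ∈ Finset.range m, Real.sqrt (b i N) :=
        Finset.sum_le_sum fun i hi => Real.sqrt_le_sqrt (hvarN i (Finset.mem_range.1 hi))

/-! ### `|W_ℓ/N| ≤ 1`: the trace of a unitary matrix -/

/-- The trace of a unitary `N × N` matrix has norm at most `N` (all entries have norm `≤ 1`).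
[folklore] -/
private theorem norm_trace_le_of_mem_unitaryGroup {𝕜 : Type*} [RCLike 𝕜] {N : ℕ}
    {V : Matrix (Fin N) (Fin N) 𝕜} (hV : V ∈ Matrix.unitaryGroup (Fin N) 𝕜) : ‖V.trace‖ ≤ N := by
  rw [Matrix.trace]
  calc ‖∑ i, V.diag i‖ ≤ ∑ i, ‖V.diag i‖ := norm_sum_le _ _
    _ ≤ ∑ _i : Fin N, (1 : ℝ) := Finset.sum_le_sum fun i _ => entry_norm_bound_of_unitary hV i i
    _ = N := by simp

/-- `‖W_ℓ(U)/N‖ ≤ 1` for the `SU(N)` Wilson loop variable `W_ℓ = Tr(U_{e₁}⋯U_{e_n})`.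
[cite: ShenZhuZhuCMP2023, §4.2 proof of Corollary 1.5 (|W_ℓ/N| ≤ 1)] -/
theorem norm_wilsonLoopTrace_fundamentalRep_div_le {d N : ℕ}
    {x : Literature.Probability.LatticeModels.Site d} (w : (zdGraph d).Walk x x)
    (U : LGConfig d (Matrix.specialUnitaryGroup (Fin N) ℂ)) :
    ‖wilsonLoopTrace (fundamentalRep (Fin N)) w U / (N : ℂ)‖ ≤ 1 := by
  rcases Nat.eq_zero_or_pos N with hN | hN
  · subst hN; simp
  have hN' : (0 : ℝ) < N := by exact_mod_cast hN
  rw [norm_div, Complex.norm_natCast, div_le_one hN', wilsonLoopTrace_apply, fundamentalRep_apply]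
  exact norm_trace_le_of_mem_unitaryGroup
    (Matrix.mem_specialUnitaryGroup_iff.1 (walkHolonomy U w).2).1

/-- `‖W_ℓ(U)/N‖ ≤ 1` for the `SO(N)` Wilson loop variable (real orthogonal matrices read in `ℂ`).
[cite: ShenZhuZhuCMP2023, §4.2 proof of Corollary 1.5 (|W_ℓ/N| ≤ 1)] -/
theorem norm_wilsonLoopTrace_specialOrthogonalRep_div_le {d N : ℕ}
    {x : Literature.Probability.LatticeModels.Site d} (w : (zdGraph d).Walk x x)
    (U : LGConfig d (Matrix.specialOrthogonalGroup (Fin N) ℝ)) :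
    ‖wilsonLoopTrace (specialOrthogonalRep (Fin N)) w U / (N : ℂ)‖ ≤ 1 := by
  rcases Nat.eq_zero_or_pos N with hN | hN
  · subst hN; simp
  have hN' : (0 : ℝ) < N := by exact_mod_cast hN
  rw [norm_div, Complex.norm_natCast, div_le_one hN', wilsonLoopTrace_apply, specialOrthogonalRep_apply]
  have hV := (Matrix.mem_specialUnitaryGroup_iff.1 (walkHolonomy U w).2).1
  rw [Matrix.trace]
  calc ‖∑ i, (((walkHolonomy U w : Matrix.specialOrthogonalGroup (Fin N) ℝ) :
          Matrix (Fin N) (Fin N) ℝ).map Complex.ofReal).diag i‖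
      ≤ ∑ i, ‖(((walkHolonomy U w : Matrix.specialOrthogonalGroup (Fin N) ℝ) :
          Matrix (Fin N) (Fin N) ℝ).map Complex.ofReal).diag i‖ :=
        norm_sum_le _ _
    _ ≤ ∑ _i : Fin N, (1 : ℝ) := Finset.sum_le_sum fun i _ => by
        rw [Matrix.diag_apply, Matrix.map_apply, Complex.norm_real]
        exact entry_norm_bound_of_unitary hV i i
    _ = N := by simp

/-! ### Measurability of the Wilson loop variables and the probability property of limit points -/

section Measurability

variable {d N : ℕ} {G : Type*} [Group G] [TopologicalSpace G] [IsTopologicalGroup G]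
  [MeasurableSpace G] [BorelSpace G] [SecondCountableTopology G]

/-- The Wilson loop variable `U ↦ Tr ρ(hol_w U)/N` of a continuous representation is continuous, hence
a.e. strongly measurable for every measure. [folklore] -/
private theorem aestronglyMeasurable_wilsonLoopTrace_div {ρ : G →* Matrix (Fin N) (Fin N) ℂ}
    (hρ : Continuous ρ) {x : Literature.Probability.LatticeModels.Site d} (w : (zdGraph d).Walk x x)
    (μ : Measure (LGConfig d G)) :
    AEStronglyMeasurable (fun U => wilsonLoopTrace ρ w U / (N : ℂ)) μ := by
  have hc : Continuous fun U : LGConfig d G => wilsonLoopTrace ρ w U / (N : ℂ) := by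
    have h1 : Continuous fun U : LGConfig d G => ρ (walkHolonomy U w) :=
      hρ.comp (continuous_walkHolonomy w)
    have h2 : Continuous fun U : LGConfig d G => (ρ (walkHolonomy U w)).trace := h1.matrix_trace
    simpa [wilsonLoopTrace] using h2.div_const (N : ℂ)
  exact hc.aestronglyMeasurable

end Measurability

/-- An infinite-volume limit point is a probability measure. [folklore] -/
private theorem isProbabilityMeasure_of_mem_infiniteVolumeLimitPoints' {d N : ℕ} {G : Type*} [Group G]
    [TopologicalSpace G] [IsTopologicalGroup G] [CompactSpace G] [MeasurableSpace G] [BorelSpace G]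
    {ρ : G →* Matrix (Fin N) (Fin N) ℂ} {β : ℝ} {μ : Measure (LGConfig d G)}
    (hμ : μ ∈ infiniteVolumeLimitPoints (d := d) ρ β) : IsProbabilityMeasure μ := by
  obtain ⟨L, -, hL⟩ := hμ
  exact hL.1

/-! ### Corollary 1.5, factorisation: `G = SU(N)` and `G = SO(N)` -/

/-- **Shen–Zhu–Zhu, Corollary 1.5, the factorisation property of Wilson loops, `G = SU(N)`** — PROVED
from the variance bound (1.12) (`shenZhuZhu_largeN_variance`). Let `d ≥ 2` and `|β| < 1/(16(d−1))`
('t Hooft coupling, uniform in `N`). For every `N` let `μ_N` be an infinite-volume limit point of the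
`SU(N)` torus states at tree coupling `Nβ` (SZZ's `μ^{YM}_{N,β}`, unique by Theorem 1.2). Then for all
loops `ℓ₁, …, ℓ_m` (closed non-backtracking walks),
`𝐄_{μ_N}[Π_i W_{ℓ_i}/N] − Π_i 𝐄_{μ_N}[W_{ℓ_i}/N] → 0` as `N → ∞` — the printed
"`lim_{N→∞} 𝐄 (W_{ℓ₁}⋯W_{ℓ_m}/N^m) = lim_{N→∞} Π_i 𝐄 (W_{ℓ_i}/N)`" in the form its proof establishes.
The variance bound gives `Var(W_ℓ/N) ≤ 4n(n−3)/(K_𝒮 N)` with `K_𝒮 = N(1/2 − 8|β|(d−1))`, so the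
variances are `O(N^{-2})`. [cite: ShenZhuZhuCMP2023, Corollary 1.5 (factorisation property of Wilson loops)] -/
theorem shenZhuZhu_largeN_factorization_SU {d : ℕ} (h : ∀ N, shenZhuZhu_largeN_variance d N)
    (hd : 2 ≤ d) {β : ℝ} (hβ : |β| < szzThresholdSU d)
    (μ : (N : ℕ) → Measure (LGConfig d (Matrix.specialUnitaryGroup (Fin N) ℂ)))
    (hμ : ∀ N, 1 ≤ N → μ N ∈ infiniteVolumeLimitPoints (d := d) (fundamentalRep (Fin N)) ((N : ℝ) * β))
    (m : ℕ) (x : ℕ → Literature.Probability.LatticeModels.Site d)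
    (w : ∀ i, (zdGraph d).Walk (x i) (x i)) (hw : ∀ i, IsNonBacktrackingLoop (w i)) :
    Tendsto (fun N : ℕ =>
        (∫ U, ∏ i ∈ Finset.range m, wilsonLoopTrace (fundamentalRep (Fin N)) (w i) U / (N : ℂ) ∂μ N) -
          ∏ i ∈ Finset.range m, ∫ U, wilsonLoopTrace (fundamentalRep (Fin N)) (w i) U / (N : ℂ) ∂μ N)
      atTop (𝓝 0) := by
  -- the constants
  set c₀ : ℝ := 1 / 2 - 8 * |β| * ((d : ℝ) - 1) with hc₀
  have hd' : (2 : ℝ) ≤ d := by exact_mod_cast hd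
  have hc₀pos : 0 < c₀ := by
    have hβ' : |β| * (16 * ((d : ℝ) - 1)) < 1 := by
      have hpos : (0 : ℝ) < 16 * ((d : ℝ) - 1) := by nlinarith
      have := hβ; rw [szzThresholdSU, lt_div_iff₀ hpos] at this; linarith
    rw [hc₀]; nlinarith
  -- `K_𝒮 = N c₀`
  have hK : ∀ N : ℕ, szzBakryEmeryConstSU N d β = N * c₀ := fun N => by
    rw [szzBakryEmeryConstSU_eq, hc₀]; ring
  -- the dominating sequences `b_i N = 4 n_i (n_i - 3) / (c₀ N²)`... stated via `K_𝒮`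
  set b : ℕ → ℕ → ℝ := fun i N =>
    4 / szzBakryEmeryConstSU N d β * (((w i).length : ℝ) * (((w i).length : ℝ) - 3) / N) with hb
  have hb0 : ∀ i, Tendsto (b i) atTop (𝓝 0) := by
    intro i
    set A : ℝ := 4 * (((w i).length : ℝ) * (((w i).length : ℝ) - 3)) / c₀ with hA
    have hb' : ∀ N : ℕ, 1 ≤ N → b i N = A * ((N : ℝ) ^ 2)⁻¹ := by
      intro N hN
      have hN : (0 : ℝ) < N := by exact_mod_cast hN
      simp only [hb, hK, hA]
      field_simp
    have hlim : Tendsto (fun N : ℕ => A * ((N : ℝ) ^ 2)⁻¹) atTop (𝓝 (A * 0)) := by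
      refine tendsto_const_nhds.mul ?_
      have h2 : Tendsto (fun N : ℕ => (N : ℝ) ^ 2) atTop atTop :=
        (tendsto_natCast_atTop_atTop (R := ℝ)).comp (tendsto_pow_atTop two_ne_zero) |>.congr
          (fun N => by simp)
      exact tendsto_inv_atTop_zero.comp h2
    rw [mul_zero] at hlim
    refine hlim.congr' ?_
    filter_upwards [eventually_ge_atTop 1] with N hN
    exact (hb' N hN).symm
  -- second countability of `SU(N)` (for measurability via continuity)
  have hSC : ∀ N : ℕ, SecondCountableTopology (Matrix.specialUnitaryGroup (Fin N) ℂ) := fun N => by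
    haveI : SecondCountableTopology (Matrix (Fin N) (Fin N) ℂ) :=
      inferInstanceAs (SecondCountableTopology (Fin N → Fin N → ℂ))
    exact Topology.IsEmbedding.subtypeVal.secondCountableTopology
  refine tendsto_integral_prod_sub_prod_integral μ ?_ m
    (fun N i U => wilsonLoopTrace (fundamentalRep (Fin N)) (w i) U / (N : ℂ)) ?_
    (fun N i U => norm_wilsonLoopTrace_fundamentalRep_div_le (w i) U) b hb0 ?_
  · filter_upwards [eventually_ge_atTop 1] with N hN
    exact isProbabilityMeasure_of_mem_infiniteVolumeLimitPoints' (hμ N hN)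
  · filter_upwards [eventually_ge_atTop 1] with N hN
    intro i
    haveI := hSC N
    exact aestronglyMeasurable_wilsonLoopTrace_div (continuous_fundamentalRep (Fin N)) (w i) (μ N)
  · filter_upwards [eventually_ge_atTop 1] with N hN
    intro i _
    have hre : (fun U => (wilsonLoopTrace (fundamentalRep (Fin N)) (w i) U / (N : ℂ)).re) =
        fun U => (wilsonLoopTrace (fundamentalRep (Fin N)) (w i) U).re / N :=
      funext fun U => Complex.div_natCast_re _ _
    have him : (fun U => (wilsonLoopTrace (fundamentalRep (Fin N)) (w i) U / (N : ℂ)).im) =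
        fun U => (wilsonLoopTrace (fundamentalRep (Fin N)) (w i) U).im / N :=
      funext fun U => Complex.div_natCast_im _ _
    rw [hre, him]
    exact (h N).1 hd hN β hβ (μ N) (hμ N hN) (x i) (w i) (hw i)

/-- **Shen–Zhu–Zhu, Corollary 1.5, the factorisation property of Wilson loops, `G = SO(N)`** — PROVED
from the variance bound (1.12) (`shenZhuZhu_largeN_variance`, second conjunct). Here Assumption 1.1
is `|β| < 1/(32(d−1)) − 1/(16N(d−1))`, which is NOT uniform in `N`; the statement assumes it in the
uniform form `|β| < β₀` with `β₀ < 1/(32(d−1))` (so that it holds for all large `N` and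
`K_𝒮 = N(1/4 − 8|β|(d−1)) − 1/2 ≥ cN` eventually). For every `N` let `μ_N` be an infinite-volume limit
point of the `SO(N)` torus states at tree coupling `Nβ`; then for all loops `ℓ₁, …, ℓ_m`,
`𝐄_{μ_N}[Π_i W_{ℓ_i}/N] − Π_i 𝐄_{μ_N}[W_{ℓ_i}/N] → 0`.
[cite: ShenZhuZhuCMP2023, Corollary 1.5 (factorisation property of Wilson loops), SO(N)] -/
theorem shenZhuZhu_largeN_factorization_SO {d : ℕ} (h : ∀ N, shenZhuZhu_largeN_variance d N)
    (hd : 2 ≤ d) {β β₀ : ℝ} (hβ₀ : β₀ < 1 / (32 * ((d : ℝ) - 1))) (hβ : |β| ≤ β₀)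
    (μ : (N : ℕ) → Measure (LGConfig d (Matrix.specialOrthogonalGroup (Fin N) ℝ)))
    (hμ : ∀ N, 1 ≤ N →
      μ N ∈ infiniteVolumeLimitPoints (d := d) (specialOrthogonalRep (Fin N)) ((N : ℝ) * β))
    (m : ℕ) (x : ℕ → Literature.Probability.LatticeModels.Site d)
    (w : ∀ i, (zdGraph d).Walk (x i) (x i)) (hw : ∀ i, IsNonBacktrackingLoop (w i)) :
    Tendsto (fun N : ℕ =>
        (∫ U, ∏ i ∈ Finset.range m, wilsonLoopTrace (specialOrthogonalRep (Fin N)) (w i) U / (N : ℂ) ∂μ N) -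
          ∏ i ∈ Finset.range m,
            ∫ U, wilsonLoopTrace (specialOrthogonalRep (Fin N)) (w i) U / (N : ℂ) ∂μ N)
      atTop (𝓝 0) := by
  have hd' : (2 : ℝ) ≤ d := by exact_mod_cast hd
  have hdpos : (0 : ℝ) < (d : ℝ) - 1 := by linarith
  -- `c₀ = 1/4 − 8 β₀ (d−1) > 0` and `K_𝒮(N) ≥ N c₀ − 1/2`
  set c₀ : ℝ := 1 / 4 - 8 * β₀ * ((d : ℝ) - 1) with hc₀
  have hc₀pos : 0 < c₀ := by
    have : β₀ * (32 * ((d : ℝ) - 1)) < 1 := by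
      rwa [lt_div_iff₀ (by positivity)] at hβ₀
    rw [hc₀]; nlinarith
  have hKge : ∀ N : ℕ, (N : ℝ) * c₀ - 1 / 2 ≤ szzBakryEmeryConstSO N d β := fun N => by
    have hN0 : (0 : ℝ) ≤ N := Nat.cast_nonneg N
    have : 8 * (N : ℝ) * |β| * ((d : ℝ) - 1) ≤ 8 * N * β₀ * ((d : ℝ) - 1) := by
      have := mul_le_mul_of_nonneg_left hβ (by positivity : (0 : ℝ) ≤ 8 * N * ((d : ℝ) - 1))
      nlinarith
    rw [szzBakryEmeryConstSO, hc₀]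
    nlinarith
  -- eventually: Assumption 1.1 holds and `K_𝒮(N) ≥ N c₀ / 2 > 0`
  have hev : ∀ᶠ N : ℕ in atTop, 1 ≤ N ∧ |β| < szzThresholdSO N d ∧
      (N : ℝ) * c₀ / 2 ≤ szzBakryEmeryConstSO N d β := by
    obtain ⟨N₀, hN₀⟩ := exists_nat_gt (1 / c₀)
    filter_upwards [eventually_ge_atTop (N₀ + 1)] with N hN
    have hN1 : 1 ≤ N := le_trans (Nat.le_add_left 1 N₀) hN
    have hNr : (N₀ : ℝ) + 1 ≤ N := by exact_mod_cast hN
    have hNc : 1 ≤ (N : ℝ) * c₀ := by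
      have : 1 / c₀ < N := lt_of_lt_of_le hN₀ (by linarith)
      rw [div_lt_iff₀ hc₀pos] at this; linarith
    have hK2 : (N : ℝ) * c₀ / 2 ≤ szzBakryEmeryConstSO N d β := by
      have := hKge N; linarith
    refine ⟨hN1, ?_, hK2⟩
    have hKpos : 0 < szzBakryEmeryConstSO N d β := lt_of_lt_of_le (by nlinarith) hK2
    exact (szzBakryEmeryConstSO_pos_iff hd hN1 β).1 hKpos
  -- dominating sequences
  set b : ℕ → ℕ → ℝ := fun i N =>
    2 / ((N : ℝ) * c₀) * (((w i).length : ℝ) * (((w i).length : ℝ) - 3) / N) with hb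
  have hb0 : ∀ i, Tendsto (b i) atTop (𝓝 0) := by
    intro i
    set A : ℝ := 2 * (((w i).length : ℝ) * (((w i).length : ℝ) - 3)) / c₀ with hA
    have hb' : ∀ N : ℕ, 1 ≤ N → b i N = A * ((N : ℝ) ^ 2)⁻¹ := by
      intro N hN
      have hN : (0 : ℝ) < N := by exact_mod_cast hN
      simp only [hb, hA]
      field_simp
    have hlim : Tendsto (fun N : ℕ => A * ((N : ℝ) ^ 2)⁻¹) atTop (𝓝 (A * 0)) := by
      refine tendsto_const_nhds.mul ?_
      have h2 : Tendsto (fun N : ℕ => (N : ℝ) ^ 2) atTop atTop :=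
        (tendsto_natCast_atTop_atTop (R := ℝ)).comp (tendsto_pow_atTop two_ne_zero) |>.congr
          (fun N => by simp)
      exact tendsto_inv_atTop_zero.comp h2
    rw [mul_zero] at hlim
    refine hlim.congr' ?_
    filter_upwards [eventually_ge_atTop 1] with N hN
    exact (hb' N hN).symm
  -- second countability of `SO(N)`
  have hSC : ∀ N : ℕ, SecondCountableTopology (Matrix.specialOrthogonalGroup (Fin N) ℝ) := fun N => by
    haveI : SecondCountableTopology (Matrix (Fin N) (Fin N) ℝ) :=
      inferInstanceAs (SecondCountableTopology (Fin N → Fin N → ℝ))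
    exact Topology.IsEmbedding.subtypeVal.secondCountableTopology
  refine tendsto_integral_prod_sub_prod_integral μ ?_ m
    (fun N i U => wilsonLoopTrace (specialOrthogonalRep (Fin N)) (w i) U / (N : ℂ)) ?_
    (fun N i U => norm_wilsonLoopTrace_specialOrthogonalRep_div_le (w i) U) b hb0 ?_
  · filter_upwards [hev] with N hN
    exact isProbabilityMeasure_of_mem_infiniteVolumeLimitPoints' (hμ N hN.1)
  · filter_upwards [hev] with N hN
    intro i
    haveI := hSC N
    exact aestronglyMeasurable_wilsonLoopTrace_div (continuous_specialOrthogonalRep (Fin N)) (w i) (μ N)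
  · filter_upwards [hev] with N hN
    intro i _
    obtain ⟨hN1, hβN, hK2⟩ := hN
    have hNpos : (0 : ℝ) < N := by exact_mod_cast hN1
    have hvar := (h N).2 hd hN1 β hβN (μ N) (hμ N hN1) (x i) (w i) (hw i)
    have hre : (fun U => (wilsonLoopTrace (specialOrthogonalRep (Fin N)) (w i) U / (N : ℂ)).re) =
        fun U => (wilsonLoopTrace (specialOrthogonalRep (Fin N)) (w i) U).re / N :=
      funext fun U => Complex.div_natCast_re _ _
    have him : (fun U => (wilsonLoopTrace (specialOrthogonalRep (Fin N)) (w i) U / (N : ℂ)).im) =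
        fun U => (wilsonLoopTrace (specialOrthogonalRep (Fin N)) (w i) U).im / N :=
      funext fun U => Complex.div_natCast_im _ _
    rw [hre, him]
    refine hvar.trans ?_
    -- `(1/K) · n(n-3)/N ≤ (2/(N c₀)) · n(n-3)/N` since `K ≥ N c₀/2 > 0` (and, were `n(n-3) < 0`, the
    -- variance bound itself would be violated by nonnegativity of variances)
    have hKpos : 0 < szzBakryEmeryConstSO N d β := lt_of_lt_of_le (by positivity) hK2
    have h1 : 1 / szzBakryEmeryConstSO N d β ≤ 2 / ((N : ℝ) * c₀) := by
      rw [div_le_div_iff₀ hKpos (by positivity)]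
      linarith
    by_cases hn : 0 ≤ ((w i).length : ℝ) * (((w i).length : ℝ) - 3)
    · exact mul_le_mul_of_nonneg_right h1 (div_nonneg hn hNpos.le)
    · exfalso
      have hneg : 1 / szzBakryEmeryConstSO N d β *
          (((w i).length : ℝ) * (((w i).length : ℝ) - 3) / N) < 0 :=
        mul_neg_of_pos_of_neg (by positivity) (div_neg_of_neg_of_pos (lt_of_not_ge hn) hNpos)
      have h0 := add_nonneg
        (variance_nonneg (fun U => (wilsonLoopTrace (specialOrthogonalRep (Fin N)) (w i) U).re / N) (μ N))
        (variance_nonneg (fun U => (wilsonLoopTrace (specialOrthogonalRep (Fin N)) (w i) U).im / N) (μ N))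
      linarith

end Literature.MathematicalPhysics.QuantumFieldTheory
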